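import Mathlib
import HarnessLib
import Summits.Ventures.LatticeQCDFlow.Exactness.WilsonFlowMasks
import Summits.Ventures.LatticeQCDFlow.Exactness.CircleGroupJacobian

/-!
# The single-link lift of a masked U(1) Wilson-flow Euler sub-step: calculus with the staples frozen, and the lattice bookkeeping that freezes them

HONEST FRAMING: exact (Metropolis-corrected) sampling algorithms for lattice gauge theory;
figures of merit are autocorrelation/cost numbers at stated couplings and volumes; no
continuum-physics claim.

Venture `LatticeQCDFlow` (cell pub-lqcd), topic `Exactness`; FANOUT row 14 (`eng-flowhmc`, engine
`latflow.fthmc`, family B; member `maps.u1_wilson_flow_lo`, twin `ref_u1`).  NEW WORK of the cell;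
nothing is cited as a fact; no number.  Second of three files typing the engine's ZERO-PARAMETER
MEMBER on the U(1) rung (`WilsonFlowMasks` ← this file ← `U1WilsonFlowLOSubstep`).  The sub-step
`(μ, class b)` of the masked Euler integration of the U(1) Wilson flow
`θ̇_ℓ = −∂_ℓ Σ_P (1 − cos θ_P)` replaces every link `(x, μ)` with `χ x = b` by

  `V(x,μ) ↦ V(x,μ) · exp(i ε Z_{x,μ}(V))`,
  `Z_{x,μ}(V) = Σ_{ν ≠ μ} [ Im P(V; x − ν̂, μ, ν) − Im P(V; x, μ, ν) ]`

(`P` = the tree's `plaquetteHolonomy` on `GaugeConfig d L Circle`; the code's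
`Z_l = Σ_ν [−sin θ_P⁺ + sin θ_P⁻]`, `maps._u1_ZC`) and books the per-link factor
`1 − ε C_{x,μ}(V)`, `C = Σ_{ν ≠ μ} [Re P(x, μ, ν) + Re P(x − ν̂, μ, ν)]`.  Here:

## Content (statements about explicit expressions; no definition is introduced)

* `im_exp_mul_coe`, `re_exp_mul_coe`, `im_coe_mul_exp_inv`, `re_coe_mul_exp_inv` — real forms of
  `Im / Re (e^{iθ} r)` and `Im / Re (q e^{−iθ})` for `r, q ∈ U(1)`.
* **`hasDerivAt_plaquetteLift`** — with the staples frozen the active angle moves by the lift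
  `Φ(θ) = θ + ε Σ_{ν ∈ s} [Im(q_ν e^{−iθ}) − Im(e^{iθ} r_ν)]`, whose derivative is
  `1 − ε Σ_{ν ∈ s} [Re(e^{iθ} r_ν) + Re(q_ν e^{−iθ})]` (= the engine's `1 − ε C`);
  `abs_plaquetteLiftC_le` (`|ε Σ …| ≤ |ε| · 2 · #s`), **`plaquetteLiftDeriv_pos`** (positive as
  soon as `2 · #s · |ε| < 1` — the refusal rule X-8 with `#s = d − 1`),
  `continuous_plaquetteLiftDeriv`, `plaquetteLift_add_two_pi` (degree one).
* `u1Substep_local` — by the frozen-staple lemma (`WilsonFlowMasks.plaquetteHolonomy_eq_of_frozen_eq`)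
  the drift `Z` and the factor `C` at an active link are functions of that link and the frozen
  links: the locality hypothesis of `WilsonFlowMasks.coupleFun_maskedUpdate` /
  `coupleJac_maskedUpdate` for this rule.
* `plaquetteHolonomy_ext`, `u1Drift_ext_eq` — with the frozen links `y` fixed and the value `g`
  on the active link (the single-link family of `coupleFun_maskedUpdate`), the two plaquettes
  through the link in the `(μ, ν)` plane are `g · r_ν` and `q_ν · g⁻¹` with `r_ν, q_ν` read off at
  `g = 1`; hence the drift and the factor, as functions of `g`, ARE the lift above and its
  derivative.
* `continuous_plaquetteHolonomy_apply` (any topological group), `continuous_u1Drift`, `continuous_u1Factor`, `measurable_ext`, `continuous_ext` — the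
  measurability / continuity inputs of the coupling-layer theorems.

NOT here: the assembly into a measurable equivalence with `HasJacobian` and the FT-HMC statement
(`U1WilsonFlowLOSubstep`); SU(N); any number.
-/

noncomputable section

namespace Summit.Ventures.LatticeQCDFlow.Exactness

open Set Function MeasureTheory Summit.Ventures.LatticeQCDFlow.Theory2
open Literature.MathematicalPhysics.QuantumFieldTheory
open scoped NNReal ENNReal

variable {d L : ℕ} {X : Type*}

/-! ## Single-link calculus: the lift driven by frozen staples -/

section LinkCalculus

/-- `Im(e^{iθ} r)` in real form. -/
theorem im_exp_mul_coe (θ : ℝ) (r : Circle) :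
    ((Circle.exp θ * r : Circle) : ℂ).im = (r : ℂ).re * Real.sin θ + (r : ℂ).im * Real.cos θ := by
  rw [Circle.coe_mul, Circle.coe_exp, Complex.exp_mul_I, ← Complex.ofReal_cos, ← Complex.ofReal_sin]
  simp only [Complex.mul_im, Complex.add_re, Complex.add_im, Complex.ofReal_re, Complex.ofReal_im,
    Complex.mul_re, Complex.I_re, Complex.I_im]
  ring

/-- `Re(e^{iθ} r)` in real form. -/
theorem re_exp_mul_coe (θ : ℝ) (r : Circle) :
    ((Circle.exp θ * r : Circle) : ℂ).re = (r : ℂ).re * Real.cos θ - (r : ℂ).im * Real.sin θ := by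
  rw [Circle.coe_mul, Circle.coe_exp, Complex.exp_mul_I, ← Complex.ofReal_cos, ← Complex.ofReal_sin]
  simp only [Complex.mul_re, Complex.add_re, Complex.add_im, Complex.ofReal_re, Complex.ofReal_im,
    Complex.mul_im, Complex.I_re, Complex.I_im]
  ring

/-- `Im(q e^{−iθ})` in real form. -/
theorem im_coe_mul_exp_inv (θ : ℝ) (q : Circle) :
    ((q * (Circle.exp θ)⁻¹ : Circle) : ℂ).im = (q : ℂ).im * Real.cos θ - (q : ℂ).re * Real.sin θ := by
  rw [← Circle.exp_neg, Circle.coe_mul, Circle.coe_exp, Complex.ofReal_neg, neg_mul, Complex.exp_neg,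
    Complex.exp_mul_I, ← Complex.ofReal_cos, ← Complex.ofReal_sin]
  have h : ((Real.cos θ : ℂ) + (Real.sin θ : ℂ) * Complex.I)⁻¹ =
      (Real.cos θ : ℂ) - (Real.sin θ : ℂ) * Complex.I := by
    rw [inv_eq_of_mul_eq_one_right]
    have := Real.cos_sq_add_sin_sq θ
    ring_nf
    rw [Complex.I_sq]
    ring_nf
    rw [← Complex.ofReal_pow, ← Complex.ofReal_pow, ← Complex.ofReal_add, this, Complex.ofReal_one]
  rw [h]
  simp only [Complex.mul_im, Complex.sub_re, Complex.sub_im, Complex.ofReal_re, Complex.ofReal_im,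
    Complex.mul_re, Complex.I_re, Complex.I_im]
  ring

/-- `Re(q e^{−iθ})` in real form. -/
theorem re_coe_mul_exp_inv (θ : ℝ) (q : Circle) :
    ((q * (Circle.exp θ)⁻¹ : Circle) : ℂ).re = (q : ℂ).re * Real.cos θ + (q : ℂ).im * Real.sin θ := by
  rw [Circle.coe_mul, Circle.coe_inv_eq_conj, Circle.coe_exp, Complex.exp_mul_I, ← Complex.ofReal_cos,
    ← Complex.ofReal_sin]
  simp only [Complex.mul_re, map_add, map_mul, Complex.conj_ofReal, Complex.conj_I, Complex.add_re,
    Complex.add_im, Complex.ofReal_re, Complex.ofReal_im, Complex.mul_im, Complex.I_re, Complex.I_im,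
    Complex.neg_re, Complex.neg_im, mul_neg]
  ring

/-- **The lift and its derivative.**  With frozen staples `r_k, q_k ∈ U(1)` the active angle
moves by `Φ(θ) = θ + ε Σ_k [Im(q_k e^{−iθ}) − Im(e^{iθ} r_k)]`, and
`Φ'(θ) = 1 − ε Σ_k [Re(e^{iθ} r_k) + Re(q_k e^{−iθ})]`. -/
theorem hasDerivAt_plaquetteLift {K : Type*} (s : Finset K) (r q : K → Circle) (ε θ : ℝ) :
    HasDerivAt
      (fun θ : ℝ => θ + ε * ∑ k ∈ s,
        (((q k * (Circle.exp θ)⁻¹ : Circle) : ℂ).im - ((Circle.exp θ * r k : Circle) : ℂ).im))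
      (1 - ε * ∑ k ∈ s,
        (((Circle.exp θ * r k : Circle) : ℂ).re + ((q k * (Circle.exp θ)⁻¹ : Circle) : ℂ).re)) θ := by
  simp only [im_exp_mul_coe, re_exp_mul_coe, im_coe_mul_exp_inv, re_coe_mul_exp_inv]
  have h : ∀ k ∈ s, HasDerivAt
      (fun θ : ℝ => ((q k : ℂ).im * Real.cos θ - (q k : ℂ).re * Real.sin θ) -
        ((r k : ℂ).re * Real.sin θ + (r k : ℂ).im * Real.cos θ))
      (-(((r k : ℂ).re * Real.cos θ - (r k : ℂ).im * Real.sin θ) +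
        ((q k : ℂ).re * Real.cos θ + (q k : ℂ).im * Real.sin θ))) θ := by
    intro k _
    have hc := Real.hasDerivAt_cos θ
    have hs := Real.hasDerivAt_sin θ
    exact (((hc.const_mul _).sub (hs.const_mul _)).sub ((hs.const_mul _).add (hc.const_mul _))).congr_deriv
      (by ring)
  exact ((hasDerivAt_id' θ).add ((HasDerivAt.fun_sum h).const_mul ε)).congr_deriv
    (by rw [Finset.sum_neg_distrib]; ring)

/-- `|Φ' − 1| ≤ |ε| · 2 · #s` (every plaquette has modulus one). -/
theorem abs_plaquetteLiftC_le {K : Type*} (s : Finset K) (r q : K → Circle) (ε θ : ℝ) :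
    |ε * ∑ k ∈ s,
        (((Circle.exp θ * r k : Circle) : ℂ).re + ((q k * (Circle.exp θ)⁻¹ : Circle) : ℂ).re)|
      ≤ |ε| * (2 * s.card) := by
  rw [abs_mul]
  refine mul_le_mul_of_nonneg_left ?_ (abs_nonneg ε)
  calc |∑ k ∈ s, (((Circle.exp θ * r k : Circle) : ℂ).re + ((q k * (Circle.exp θ)⁻¹ : Circle) : ℂ).re)|
      ≤ ∑ k ∈ s, |((Circle.exp θ * r k : Circle) : ℂ).re + ((q k * (Circle.exp θ)⁻¹ : Circle) : ℂ).re| :=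
        Finset.abs_sum_le_sum_abs _ _
    _ ≤ ∑ k ∈ s, (2 : ℝ) := Finset.sum_le_sum fun k _ => ?_
    _ = 2 * s.card := by simp [mul_comm]
  calc |((Circle.exp θ * r k : Circle) : ℂ).re + ((q k * (Circle.exp θ)⁻¹ : Circle) : ℂ).re|
      ≤ |((Circle.exp θ * r k : Circle) : ℂ).re| + |((q k * (Circle.exp θ)⁻¹ : Circle) : ℂ).re| :=
        abs_add_le _ _
    _ ≤ 1 + 1 := add_le_add
        ((Complex.abs_re_le_norm _).trans (Circle.norm_coe _).le)
        ((Complex.abs_re_le_norm _).trans (Circle.norm_coe _).le)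
    _ = 2 := by norm_num

/-- **Inside the refusal rule the derivative is positive**: `2 · #s · |ε| < 1 ⇒ Φ' > 0`. -/
theorem plaquetteLiftDeriv_pos {K : Type*} (s : Finset K) (r q : K → Circle) {ε : ℝ}
    (hε : |ε| * (2 * s.card) < 1) (θ : ℝ) :
    0 < 1 - ε * ∑ k ∈ s,
        (((Circle.exp θ * r k : Circle) : ℂ).re + ((q k * (Circle.exp θ)⁻¹ : Circle) : ℂ).re) := by
  have h := (abs_le.mp (abs_plaquetteLiftC_le s r q ε θ)).2
  linarith

/-- `Φ'` is continuous. -/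
theorem continuous_plaquetteLiftDeriv {K : Type*} (s : Finset K) (r q : K → Circle) (ε : ℝ) :
    Continuous fun θ : ℝ => 1 - ε * ∑ k ∈ s,
        (((Circle.exp θ * r k : Circle) : ℂ).re + ((q k * (Circle.exp θ)⁻¹ : Circle) : ℂ).re) := by
  simp only [re_exp_mul_coe, re_coe_mul_exp_inv]
  fun_prop

/-- `Φ` has degree one: `Φ(θ + 2π) = Φ(θ) + 2π`. -/
theorem plaquetteLift_add_two_pi {K : Type*} (s : Finset K) (r q : K → Circle) (ε θ : ℝ) :
    (θ + 2 * Real.pi) + ε * ∑ k ∈ s,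
        (((q k * (Circle.exp (θ + 2 * Real.pi))⁻¹ : Circle) : ℂ).im -
          ((Circle.exp (θ + 2 * Real.pi) * r k : Circle) : ℂ).im) =
      (θ + ε * ∑ k ∈ s,
        (((q k * (Circle.exp θ)⁻¹ : Circle) : ℂ).im - ((Circle.exp θ * r k : Circle) : ℂ).im)) +
        2 * Real.pi := by
  rw [Circle.exp_add_two_pi]; ring

end LinkCalculus

/-! ## Lattice bookkeeping for the U(1) sub-step -/

section Lattice

variable [DecidableEq X] (χ : Site d L → X)

omit [DecidableEq X] in
/-- **Locality of the drift and of the factor.**  For a proper colouring `χ`, if `V` and `W`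
agree on the active link `e` (direction `μ`, base colour `b`) and on every frozen link, then the
drift sums `Z_e` and the factor sums `C_e` computed from `V` and from `W` agree. -/
theorem u1Substep_local (hχ : ∀ (x : Site d L) (i : Fin d), χ (x.shift i) ≠ χ x)
    (μ : Fin d) (b : X) {V W : GaugeConfig d L Circle} {e : Edge d L}
    (he : e.2 = μ ∧ χ e.1 = b) (ha : V e = W e)
    (hVW : ∀ j : Edge d L, ¬(j.2 = μ ∧ χ j.1 = b) → V j = W j) :
    (∑ ν ∈ Finset.univ.erase e.2,
        (((plaquetteHolonomy V (e.1 - Pi.single ν 1) e.2 ν : Circle) : ℂ).im -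
          ((plaquetteHolonomy V e.1 e.2 ν : Circle) : ℂ).im)) =
      (∑ ν ∈ Finset.univ.erase e.2,
        (((plaquetteHolonomy W (e.1 - Pi.single ν 1) e.2 ν : Circle) : ℂ).im -
          ((plaquetteHolonomy W e.1 e.2 ν : Circle) : ℂ).im)) ∧
    (∑ ν ∈ Finset.univ.erase e.2,
        (((plaquetteHolonomy V e.1 e.2 ν : Circle) : ℂ).re +
          ((plaquetteHolonomy V (e.1 - Pi.single ν 1) e.2 ν : Circle) : ℂ).re)) =
      (∑ ν ∈ Finset.univ.erase e.2,
        (((plaquetteHolonomy W e.1 e.2 ν : Circle) : ℂ).re +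
          ((plaquetteHolonomy W (e.1 - Pi.single ν 1) e.2 ν : Circle) : ℂ).re)) := by
  obtain ⟨x, μ'⟩ := e
  obtain ⟨rfl, hx⟩ := he
  constructor <;> refine Finset.sum_congr rfl fun ν hν => ?_ <;>
    obtain ⟨h1, h2⟩ := plaquetteHolonomy_eq_of_frozen_eq χ hχ hVW hx (Finset.ne_of_mem_erase hν) ha <;>
    simp only [h1, h2]

/-- **The plaquettes through the active link, with the frozen links fixed and the link set to `g`**,
are `g · r_ν` (at the base point) and `q_ν · g⁻¹` (at the base point minus `ν̂`), where `r_ν`, `q_ν`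
are the same plaquettes read off at `g = 1` (abelian group; the other three links of each
plaquette are not the active link: proper colouring, `ν ≠ μ`). -/
theorem plaquetteHolonomy_ext (hχ : ∀ (x : Site d L) (i : Fin d), χ (x.shift i) ≠ χ x)
    {μ : Fin d} {b : X} (a : {e : Edge d L // e.2 = μ ∧ χ e.1 = b})
    (y : {e : Edge d L // ¬(e.2 = μ ∧ χ e.1 = b)} → Circle) (g : Circle) {ν : Fin d}
    (hν : ν ≠ a.1.2) :
    plaquetteHolonomy
        (fun j : Edge d L => if h : j.2 = μ ∧ χ j.1 = b then (if j = a.1 then g else 1) else y ⟨j, h⟩)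
        a.1.1 a.1.2 ν =
      g * plaquetteHolonomy
        (fun j : Edge d L => if h : j.2 = μ ∧ χ j.1 = b then (if j = a.1 then (1 : Circle) else 1)
          else y ⟨j, h⟩) a.1.1 a.1.2 ν ∧
    plaquetteHolonomy
        (fun j : Edge d L => if h : j.2 = μ ∧ χ j.1 = b then (if j = a.1 then g else 1) else y ⟨j, h⟩)
        (a.1.1 - Pi.single ν 1) a.1.2 ν =
      plaquetteHolonomy
        (fun j : Edge d L => if h : j.2 = μ ∧ χ j.1 = b then (if j = a.1 then (1 : Circle) else 1)
          else y ⟨j, h⟩) (a.1.1 - Pi.single ν 1) a.1.2 ν * g⁻¹ := by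
  set Wg : GaugeConfig d L Circle := (fun j : Edge d L =>
    if h : j.2 = μ ∧ χ j.1 = b then (if j = a.1 then g else 1) else y ⟨j, h⟩) with hWg
  set W1 : GaugeConfig d L Circle := (fun j : Edge d L =>
    if h : j.2 = μ ∧ χ j.1 = b then (if j = a.1 then (1 : Circle) else 1) else y ⟨j, h⟩) with hW1
  have key : ∀ j : Edge d L, j ≠ a.1 → Wg j = W1 j := by
    intro j hj
    simp only [hWg, hW1]
    by_cases h : j.2 = μ ∧ χ j.1 = b
    · rw [dif_pos h, dif_pos h, if_neg hj, if_neg hj]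
    · rw [dif_neg h, dif_neg h]
  have hga : Wg a.1 = g := by simp only [hWg]; rw [dif_pos a.2, if_true]
  have h1a : W1 a.1 = 1 := by simp only [hW1]; rw [dif_pos a.2, if_true]
  have hne1 : ((a.1.1.shift ν, a.1.2) : Edge d L) ≠ a.1 := (shift_edge_ne χ hχ a.1.1 a.1.2 ν).1
  have hne2 : ((a.1.1 - Pi.single ν 1, a.1.2) : Edge d L) ≠ a.1 :=
    (shift_edge_ne χ hχ a.1.1 a.1.2 ν).2
  have hne3 : ((a.1.1.shift a.1.2, ν) : Edge d L) ≠ a.1 := fun h => hν (congrArg Prod.snd h)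
  have hne4 : ((a.1.1, ν) : Edge d L) ≠ a.1 := fun h => hν (congrArg Prod.snd h)
  have hne5 : (((a.1.1 - Pi.single ν 1).shift a.1.2, ν) : Edge d L) ≠ a.1 :=
    fun h => hν (congrArg Prod.snd h)
  have hne6 : ((a.1.1 - Pi.single ν 1, ν) : Edge d L) ≠ a.1 := fun h => hν (congrArg Prod.snd h)
  simp only [plaquetteHolonomy, shift_sub_single]
  rw [show ((a.1.1, a.1.2) : Edge d L) = a.1 from Prod.mk.eta, hga, h1a, key _ hne3, key _ hne1,
    key _ hne4, key _ hne2, key _ hne5, key _ hne6]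
  constructor
  · simp only [one_mul, mul_assoc]
  · simp only [inv_one, mul_one]
    exact mul_right_comm _ _ _

/-- A plaquette holonomy is a continuous function of the field (any topological group). -/
theorem continuous_plaquetteHolonomy_apply {G : Type*} [Group G] [TopologicalSpace G]
    [IsTopologicalGroup G] (x : Site d L) (μ ν : Fin d) :
    Continuous fun W : GaugeConfig d L G => plaquetteHolonomy W x μ ν := by
  unfold plaquetteHolonomy
  fun_prop

/-- The drift `ε Z_e(W)` is continuous in the field. -/
theorem continuous_u1Drift (e : Edge d L) (ε : ℝ) :
    Continuous fun W : GaugeConfig d L Circle => ε * ∑ ν ∈ Finset.univ.erase e.2,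
        (((plaquetteHolonomy W (e.1 - Pi.single ν 1) e.2 ν : Circle) : ℂ).im -
          ((plaquetteHolonomy W e.1 e.2 ν : Circle) : ℂ).im) := by
  have hcoe : Continuous fun z : Circle => (z : ℂ) := continuous_subtype_val
  refine continuous_const.mul (continuous_finsetSum _ fun ν _ => ?_)
  exact (Complex.continuous_im.comp (hcoe.comp (continuous_plaquetteHolonomy_apply _ _ _))).sub
    (Complex.continuous_im.comp (hcoe.comp (continuous_plaquetteHolonomy_apply _ _ _)))

/-- The factor `1 − ε C_e(W)` is continuous in the field. -/
theorem continuous_u1Factor (e : Edge d L) (ε : ℝ) :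
    Continuous fun W : GaugeConfig d L Circle => 1 - ε * ∑ ν ∈ Finset.univ.erase e.2,
        (((plaquetteHolonomy W e.1 e.2 ν : Circle) : ℂ).re +
          ((plaquetteHolonomy W (e.1 - Pi.single ν 1) e.2 ν : Circle) : ℂ).re) := by
  have hcoe : Continuous fun z : Circle => (z : ℂ) := continuous_subtype_val
  refine continuous_const.sub (continuous_const.mul (continuous_finsetSum _ fun ν _ => ?_))
  exact (Complex.continuous_re.comp (hcoe.comp (continuous_plaquetteHolonomy_apply _ _ _))).add
    (Complex.continuous_re.comp (hcoe.comp (continuous_plaquetteHolonomy_apply _ _ _)))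

/-- The filled field (frozen links `w.2`, active link `a` set to `e^{i w.1}`, other active links
`1`) is jointly measurable in `w`. -/
theorem measurable_ext {μ : Fin d} {b : X} (a : {e : Edge d L // e.2 = μ ∧ χ e.1 = b}) :
    Measurable fun w : ℝ × ({e : Edge d L // ¬(e.2 = μ ∧ χ e.1 = b)} → Circle) =>
      (fun j : Edge d L => if h : j.2 = μ ∧ χ j.1 = b then (if j = a.1 then Circle.exp w.1 else 1)
        else w.2 ⟨j, h⟩) := by
  refine measurable_pi_lambda _ fun j => ?_
  by_cases hj : j.2 = μ ∧ χ j.1 = b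
  · by_cases hja : j = a.1
    · simp only [dif_pos hj, if_pos hja]
      exact Circle.exp.continuous.measurable.comp measurable_fst
    · simp only [dif_pos hj, if_neg hja]
      exact measurable_const
  · simp only [dif_neg hj]
    exact (measurable_pi_apply _).comp measurable_snd

/-- The filled field is continuous in the active angle. -/
theorem continuous_ext {μ : Fin d} {b : X} (a : {e : Edge d L // e.2 = μ ∧ χ e.1 = b})
    (y : {e : Edge d L // ¬(e.2 = μ ∧ χ e.1 = b)} → Circle) :
    Continuous fun θ : ℝ =>
      (fun j : Edge d L => if h : j.2 = μ ∧ χ j.1 = b then (if j = a.1 then Circle.exp θ else 1)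
        else y ⟨j, h⟩) := by
  refine continuous_pi fun j => ?_
  by_cases hj : j.2 = μ ∧ χ j.1 = b
  · by_cases hja : j = a.1
    · simp only [dif_pos hj, if_pos hja]
      exact Circle.exp.continuous
    · simp only [dif_pos hj, if_neg hja]
      exact continuous_const
  · simp only [dif_neg hj]
    exact continuous_const

/-- With the frozen links fixed, the drift and the factor at the active link, as functions of the
value `g` of that link, in the single-link form of `hasDerivAt_plaquetteLift` (staples read off
at `g = 1`). -/
theorem u1Drift_ext_eq (hχ : ∀ (x : Site d L) (i : Fin d), χ (x.shift i) ≠ χ x)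
    {μ : Fin d} {b : X} (a : {e : Edge d L // e.2 = μ ∧ χ e.1 = b})
    (y : {e : Edge d L // ¬(e.2 = μ ∧ χ e.1 = b)} → Circle) (g : Circle) (ε : ℝ) :
    (ε * ∑ ν ∈ Finset.univ.erase a.1.2,
            (((plaquetteHolonomy (fun j : Edge d L => if h : j.2 = μ ∧ χ j.1 = b then (if j = a.1 then g else 1) else y ⟨j, h⟩) (a.1.1 - Pi.single ν 1) a.1.2 ν : Circle) : ℂ).im -
              ((plaquetteHolonomy (fun j : Edge d L => if h : j.2 = μ ∧ χ j.1 = b then (if j = a.1 then g else 1) else y ⟨j, h⟩) a.1.1 a.1.2 ν : Circle) : ℂ).im)) =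
      ε * ∑ ν ∈ Finset.univ.erase a.1.2,
        (((plaquetteHolonomy (fun j : Edge d L => if h : j.2 = μ ∧ χ j.1 = b then (if j = a.1 then (1 : Circle) else 1) else y ⟨j, h⟩) (a.1.1 - Pi.single ν 1) a.1.2 ν * g⁻¹ :
            Circle) : ℂ).im -
          ((g * plaquetteHolonomy (fun j : Edge d L => if h : j.2 = μ ∧ χ j.1 = b then (if j = a.1 then (1 : Circle) else 1) else y ⟨j, h⟩) a.1.1 a.1.2 ν : Circle) : ℂ).im) ∧
    (1 - ε * ∑ ν ∈ Finset.univ.erase a.1.2,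
            (((plaquetteHolonomy (fun j : Edge d L => if h : j.2 = μ ∧ χ j.1 = b then (if j = a.1 then g else 1) else y ⟨j, h⟩) a.1.1 a.1.2 ν : Circle) : ℂ).re +
              ((plaquetteHolonomy (fun j : Edge d L => if h : j.2 = μ ∧ χ j.1 = b then (if j = a.1 then g else 1) else y ⟨j, h⟩) (a.1.1 - Pi.single ν 1) a.1.2 ν : Circle) : ℂ).re)) =
      1 - ε * ∑ ν ∈ Finset.univ.erase a.1.2,
        (((g * plaquetteHolonomy (fun j : Edge d L => if h : j.2 = μ ∧ χ j.1 = b then (if j = a.1 then (1 : Circle) else 1) else y ⟨j, h⟩) a.1.1 a.1.2 ν : Circle) : ℂ).re +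
          ((plaquetteHolonomy (fun j : Edge d L => if h : j.2 = μ ∧ χ j.1 = b then (if j = a.1 then (1 : Circle) else 1) else y ⟨j, h⟩) (a.1.1 - Pi.single ν 1) a.1.2 ν * g⁻¹ :
            Circle) : ℂ).re) := by
  constructor
  · congr 1
    refine Finset.sum_congr rfl fun ν hν => ?_
    obtain ⟨h1, h2⟩ := plaquetteHolonomy_ext χ hχ a y g (Finset.ne_of_mem_erase hν)
    rw [h1, h2]
  · congr 1
    congr 1
    refine Finset.sum_congr rfl fun ν hν => ?_
    obtain ⟨h1, h2⟩ := plaquetteHolonomy_ext χ hχ a y g (Finset.ne_of_mem_erase hν)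
    rw [h1, h2]

end Lattice

end Summit.Ventures.LatticeQCDFlow.Exactness
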